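/-
COR-CM (cell pub-hodgecm2, stage 2 of the Hodge ladder) — count-neutral KERNEL COMBINATORICS «spectator doubling G = H × ⟨x⟩ (x a CENTRAL involution
outside the index-two subgroup H ∋ c), part III: the stabiliser characters of (G, c) are those of (H, c), so d₂(G/𝒦) = d₂(H/𝒦_H),
φ₂(G, c) + 2 = β(G, c) + d₂(H/𝒦_H), and the floor μ(G, c) ≥ β(G, c) − 2 + d₂(H/𝒦_H)» (seat prover-pub-hodgecm2-b23-g47-0, binder prover b23,
gen 47; claim «SPECTATOR DOUBLING», HOME/INBOX.md l.21993).  Theorems only (no definition), on top of lit-andre-3ʼs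
`Census/TypeStabiliser*`, b09ʼs `Census/HalfParityCount` / `Census/CoinvariantFloor` (through `Census/OcticProductStabiliser` §4) and gen 46ʼs
`Census/IndexTwoSplitDihedralFloor` BY NAME; no `decide`, no certificate, no named fact, no `sorry`; `Interfaces.lean` (C1), every E term, B01,
`Transposition/*`, `PortJoin/*`, `D2Bridge/*` untouched.
HONEST FRAMING: `HC_CM` is NOT proved, here or anywhere in the tree; nothing here is a period, a count of record or a headline.
T5: n/a-class (hypothesis binders: `c * c = 1`, `c ≠ 1`, `c` central, `c ∈ H`, `H.index = 2`, `x ∉ H`, `x * x = 1`, `x` central); checker: self.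
-/
import Summits.HodgeConjecture.CorCM.Census.IndexTwoSplitDihedralFloor

/-!
# Spectator doubling `G = H × ⟨x⟩`, III: `d₂` is inherited, `φ₂(G, c) + 2 = β(G, c) + d₂(H/𝒦_H)`, and the floor

THE SETTING: `c ≠ 1` a central involution of the finite group `G`, `H ∋ c` a subgroup of index two, `x ∉ H` CENTRAL with `x · x = 1`, so that
`G = H × ⟨x⟩` (the Galois CM field is a compositum `F₀ · k` with a disjoint real quadratic field `k`).

* §1 The extension `g ↦ ψ(g)` on `H`, `g ↦ ψ(x g)` off `H` of an additive `ψ : H → 𝔽₂` is additive (`extend_add`) — the projection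
  `G = H × ⟨x⟩ → H` is a homomorphism because `x` is central of order two.
* §2 **The stabiliser characters restrict bijectively** `𝔛(G, c) ≃ 𝔛(H, c)`: a character of `G` killing `𝒦(G, c)` kills `x` (an
  involution, lit-andre-3ʼs `mem_stabGen_of_mul_self_eq_one`), so it is determined by its restriction (`restrict_mem_charK`); conversely the
  extension of `ψ ∈ 𝔛(H, c)` kills `𝒦(G, c)` (`extend_mem_charK`) — an element `x h` with `c ∉ ⟨x h⟩` has `c ∉ ⟨h²⟩`, and then `ψ(h) = 0`
  whether or not `c ∈ ⟨h⟩` (`apply_eq_zero_of_sq`).  Hence **`d₂(G/𝒦(G,c)) = d₂(H/𝒦(H,c))`** (`indexTwoRank_stabGen_spectator`).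
* §3 **`φ₂(G, c) + 2 = β(G, c) + d₂(H/𝒦_H)`** (`fibreTwo_add_two_spectator`; `|G|/2 = |H|` is even) and, against `(H, c)`:
  `φ₂(G, c) + β(H, c) + 1 = φ₂(H, c) + [|H|/2 even] + β(G, c)` (`fibreTwo_spectator_eq`) — for `|H|/2` even the fibre grows by EXACTLY the number
  of new blocks, `φ₂(G, c) − φ₂(H, c) = β(G, c) − β(H, c)`; for `|H|/2` odd by one less.
* §4 **THE FLOOR** (`card_block_add_le_spectator`): every face family generating `hodgeSpan (G, c)` modulo pairs has at least
  `β(G, c) + d₂(H/𝒦_H) − 2` members.  With part II (`Census/SpectatorClosing.lean`):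
  `β(G,c) − 2 + d₂(H/𝒦_H) ≤ μ(G, c) ≤ μ(H, c) + #{far blocks} + (|H|/2)·#{neighbour blocks}`; numerically the floor is attained
  (design note `HOME/pub-hodgecm2-b23/SPECTATOR.md`).

## References
* [Pohlmann1968] H. Pohlmann, Algebraic cycles on abelian varieties of complex multiplication type, Ann. of Math. 88 (1968), Thm 1.
-/

namespace Summit.HodgeConjecture.CorCM.Census.Spectator

open Finset
open Summit.HodgeConjecture.CorCM.Prior.AllgGroup.RfwfAllgGroup
open Summit.HodgeConjecture.CorCM.Census.BlockParity
open Summit.HodgeConjecture.CorCM.Census.Coinvariant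
open Summit.HodgeConjecture.CorCM.Census.HalfParity
open Summit.HodgeConjecture.CorCM.Census.TypeStabiliser
open Summit.HodgeConjecture.CorCM.Census.IndexTwo
open Summit.HodgeConjecture.CorCM.Census.IndexTwoDescent

noncomputable section

variable {G : Type*} [Group G] [Fintype G] [DecidableEq G] {c : G}
variable {H : Subgroup G} [DecidablePred (· ∈ H)]

/-! ## §1 Extending a character of `H` along the central involution `x` -/

omit [Fintype G] [DecidableEq G] [DecidablePred (· ∈ H)] in
/-- `x · g ∈ H ↔ g ∉ H` packaged: the `H`-component of `g ∉ H` is `x · g`. [folklore] -/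
theorem xmul_mem_of_not_mem (hH : H.index = 2) {x : G} (hx : x ∉ H) {g : G} (hg : g ∉ H) : x * g ∈ H :=
  (mul_mem_iff_not_mem hH hx g).mpr hg

omit [Fintype G] [DecidableEq G] in
/-- **The extension `g ↦ ψ(g)` (`g ∈ H`), `g ↦ ψ(x g)` (`g ∉ H`) of an additive `ψ : H → 𝔽₂` is additive** — because `x` is central with
`x · x = 1` (the projection `G = H × ⟨x⟩ → H` is a homomorphism). [folklore] -/
theorem extend_add (hH : H.index = 2) {x : G} (hx : x ∉ H) (hxx : x * x = 1) (hxc : ∀ g : G, g * x = x * g) (ψ : H → ZMod 2)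
    (hψ : ∀ a b : H, ψ (a * b) = ψ a + ψ b) (a b : G) :
    (fun g : G => if hg : g ∈ H then ψ ⟨g, hg⟩ else ψ ⟨x * g, xmul_mem_of_not_mem hH hx hg⟩) (a * b) =
      (fun g : G => if hg : g ∈ H then ψ ⟨g, hg⟩ else ψ ⟨x * g, xmul_mem_of_not_mem hH hx hg⟩) a +
      (fun g : G => if hg : g ∈ H then ψ ⟨g, hg⟩ else ψ ⟨x * g, xmul_mem_of_not_mem hH hx hg⟩) b := by
  by_cases ha : a ∈ H <;> by_cases hb : b ∈ H
  · have hab : a * b ∈ H := H.mul_mem ha hb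
    simp only [ha, hb, hab, dif_pos, ← hψ]; rfl
  · have hab : a * b ∉ H := fun h => hb (by simpa using H.mul_mem (H.inv_mem ha) h)
    simp only [ha, hb, hab, dif_pos, dif_neg, not_false_eq_true, ← hψ]
    congr 1; apply Subtype.ext
    show x * (a * b) = a * (x * b)
    rw [← mul_assoc, ← mul_assoc, hxc a]
  · have hab : a * b ∉ H := fun h => ha (by simpa using H.mul_mem h (H.inv_mem hb))
    simp only [ha, hb, hab, dif_pos, dif_neg, not_false_eq_true, ← hψ]
    congr 1; apply Subtype.ext
    show x * (a * b) = x * a * b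
    rw [mul_assoc]
  · have hab : a * b ∈ H := by
      have h := H.mul_mem (xmul_mem_of_not_mem hH hx ha) (xmul_mem_of_not_mem hH hx hb)
      rwa [show x * a * (x * b) = a * b by rw [mul_assoc, ← mul_assoc a, hxc a, mul_assoc, ← mul_assoc, hxx, one_mul]] at h
    simp only [ha, hb, hab, dif_pos, dif_neg, not_false_eq_true, ← hψ]
    congr 1; apply Subtype.ext
    show a * b = x * a * (x * b)
    rw [mul_assoc, ← mul_assoc a, hxc a, mul_assoc, ← mul_assoc, hxx, one_mul]

/-! ## §2 Stabiliser characters restrict bijectively: `d₂(G/𝒦) = d₂(H/𝒦_H)` -/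

omit [Fintype G] [DecidableEq G] [DecidablePred (· ∈ H)] in
/-- `c ∈ ⟨h⟩` in `H` iff `c ∈ ⟨h⟩` in `G`. [folklore] -/
theorem csub_mem_zpowers_iff (hcH : c ∈ H) (h : H) :
    (⟨c, hcH⟩ : H) ∈ Subgroup.zpowers h ↔ c ∈ Subgroup.zpowers (h : G) := by
  constructor
  · rintro ⟨n, hn⟩
    exact ⟨n, by have := congrArg Subtype.val hn; simpa using this⟩
  · rintro ⟨n, hn⟩
    exact ⟨n, Subtype.ext (by simpa using hn)⟩

omit [DecidableEq G] in
/-- An additive `ψ : K → 𝔽₂` satisfies `ψ (h ^ n) = n • ψ h`. [folklore] -/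
theorem apply_pow_of_add {K : Type*} [Group K] (ψ : K → ZMod 2) (hadd : ∀ a b : K, ψ (a * b) = ψ a + ψ b) (h : K) (n : ℕ) :
    ψ (h ^ n) = n • ψ h := by
  induction n with
  | zero => rw [pow_zero, zero_smul]; exact apply_one_eq_zero_of_add ψ hadd
  | succ n ih => rw [pow_succ, hadd, ih, succ_nsmul]

/-- **The key vanishing**: if `ψ ∈ 𝔛(H, c)` and `c ∉ ⟨x h⟩` for the central involution `x`, then `ψ h = 0` — for `c ∉ ⟨x h⟩ ∋ h²` forces
`c ∉ ⟨h²⟩`, so either `c ∉ ⟨h⟩` (`h ∈ 𝒦_H`) or `c` is an ODD power of `h` (`ψ h = ψ c = 0`). [folklore] -/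
theorem apply_eq_zero_of_sq (hcH : c ∈ H) (hc2 : c * c = 1) (hcen : ∀ g : G, g * c = c * g) {x : G} (hxx : x * x = 1)
    (hxc : ∀ g : G, g * x = x * g) {ψ : H → ZMod 2} (hψ : ψ ∈ charK (⟨c, hcH⟩ : H)) (h : H)
    (hg : c ∉ Subgroup.zpowers (x * (h : G))) : ψ h = 0 := by
  have hc2' := csub_mul_csub hcH hc2
  have hcen' : ∀ k : H, k * ⟨c, hcH⟩ = ⟨c, hcH⟩ * k := fun k => csub_comm hcH hcen k
  by_cases hch : (⟨c, hcH⟩ : H) ∈ Subgroup.zpowers h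
  · -- `c = h ^ k`; `k` must be odd
    obtain ⟨k, hk⟩ := (mem_powers_iff_mem_zpowers.mpr hch)
    change h ^ k = ⟨c, hcH⟩ at hk
    have hsq : (x * (h : G)) ^ 2 = (h : G) ^ 2 := by
      rw [pow_two, pow_two, mul_assoc, ← mul_assoc (h : G), hxc (h : G), mul_assoc, ← mul_assoc, hxx, one_mul]
    have hodd : ¬ 2 ∣ k := by
      rintro ⟨m, rfl⟩
      apply hg
      have e : (x * (h : G)) ^ (2 * m) = c := by
        rw [pow_mul, hsq, ← pow_mul, ← Subgroup.coe_pow, hk]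
      rw [← e]
      exact Subgroup.npow_mem_zpowers _ _
    have hψadd := ((mem_charK _ ψ).mp hψ).1
    have hψc : ψ ⟨c, hcH⟩ = 0 := ((mem_charK _ ψ).mp hψ).2.1
    have e := apply_pow_of_add ψ hψadd h k
    rw [hk, hψc] at e
    have hk2 : (k : ZMod 2) = 1 := by
      rcases Nat.even_or_odd k with ⟨m, hm⟩ | ⟨m, hm⟩
      · exact absurd ⟨m, by omega⟩ hodd
      · rw [hm]; push_cast; rw [show (2 : ZMod 2) = 0 from rfl]; ring
    rw [nsmul_eq_mul, hk2, one_mul] at e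
    exact e.symm
  · exact apply_eq_zero_of_mem_charK _ hc2' hcen' hψ (mem_stabGen_of_notMem_zpowers _ hch)

/-- The restriction of a stabiliser character of `(G, c)` to `H` is a stabiliser character of `(H, c)`. [folklore] -/
theorem restrict_mem_charK (hcH : c ∈ H) (hc2 : c * c = 1) (hcen : ∀ g : G, g * c = c * g) {χ : G → ZMod 2} (hχ : χ ∈ charK c) :
    (fun h : H => χ h) ∈ charK (⟨c, hcH⟩ : H) := by
  have hc2' := csub_mul_csub hcH hc2
  have hcen' : ∀ k : H, k * ⟨c, hcH⟩ = ⟨c, hcH⟩ * k := fun k => csub_comm hcH hcen k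
  have hadd := ((mem_charK c χ).mp hχ).1
  refine mem_charK_of_forall _ hc2' hcen' (fun a b => by simp only [Subgroup.coe_mul]; exact hadd a b) fun g hg => ?_
  have hle : stabGen (⟨c, hcH⟩ : H) ≤ (addKer χ hadd).comap H.subtype := by
    rw [stabGen_le_iff_subset]
    refine ⟨(mem_addKer χ hadd c).mpr (apply_eq_zero_of_mem_charK c hc2 hcen hχ (self_mem_stabGen c)), fun h hh => ?_⟩
    exact (mem_addKer χ hadd (h : G)).mpr
      (apply_eq_zero_of_mem_charK c hc2 hcen hχ (mem_stabGen_of_notMem_zpowers c (fun hc => hh ((csub_mem_zpowers_iff hcH h).mpr hc))))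
  exact (mem_addKer χ hadd (g : G)).mp (hle hg)

/-- **The extension of a stabiliser character of `(H, c)` along `x` is a stabiliser character of `(G, c)`** (`x` central, `x·x = 1`).
[folklore] -/
theorem extend_mem_charK (hcH : c ∈ H) (hc2 : c * c = 1) (hcen : ∀ g : G, g * c = c * g) (hH : H.index = 2)
    {x : G} (hx : x ∉ H) (hxx : x * x = 1) (hxc : ∀ g : G, g * x = x * g) {ψ : H → ZMod 2} (hψ : ψ ∈ charK (⟨c, hcH⟩ : H)) :
    (fun g : G => if hg : g ∈ H then ψ ⟨g, hg⟩ else ψ ⟨x * g, xmul_mem_of_not_mem hH hx hg⟩) ∈ charK c := by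
  have hc2' := csub_mul_csub hcH hc2
  have hcen' : ∀ k : H, k * ⟨c, hcH⟩ = ⟨c, hcH⟩ * k := fun k => csub_comm hcH hcen k
  have hψadd := ((mem_charK _ ψ).mp hψ).1
  set χ : G → ZMod 2 := fun g : G => if hg : g ∈ H then ψ ⟨g, hg⟩ else ψ ⟨x * g, xmul_mem_of_not_mem hH hx hg⟩ with hχ
  have hadd : ∀ a b : G, χ (a * b) = χ a + χ b := extend_add hH hx hxx hxc ψ hψadd
  refine mem_charK_of_forall c hc2 hcen hadd fun g hg => ?_
  have hle : stabGen c ≤ addKer χ hadd := by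
    rw [stabGen_le_iff_subset]
    refine ⟨(mem_addKer χ hadd c).mpr ?_, fun g hg => (mem_addKer χ hadd g).mpr ?_⟩
    · show (if hg : c ∈ H then ψ ⟨c, hg⟩ else ψ ⟨x * c, xmul_mem_of_not_mem hH hx hg⟩) = 0
      rw [dif_pos hcH]
      exact ((mem_charK _ ψ).mp hψ).2.1
    · show (if hg : g ∈ H then ψ ⟨g, hg⟩ else ψ ⟨x * g, xmul_mem_of_not_mem hH hx hg⟩) = 0
      by_cases hgH : g ∈ H
      · rw [dif_pos hgH]
        exact apply_eq_zero_of_mem_charK _ hc2' hcen' hψ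
          (mem_stabGen_of_notMem_zpowers _ fun hc => hg ((csub_mem_zpowers_iff hcH ⟨g, hgH⟩).mp hc))
      · rw [dif_neg hgH]
        refine apply_eq_zero_of_sq hcH hc2 hcen hxx hxc hψ _ ?_
        have e : x * (((⟨x * g, xmul_mem_of_not_mem hH hx hgH⟩ : H)) : G) = g := by
          show x * (x * g) = g
          rw [← mul_assoc, hxx, one_mul]
        rw [e]; exact hg
  exact (mem_addKer χ hadd g).mp (hle hg)

/-- **`d₂(G/𝒦(G, c)) = d₂(H/𝒦(H, c))`** for the spectator doubling `G = H × ⟨x⟩`: restriction `𝔛(G, c) → 𝔛(H, c)` is an `𝔽₂`-linear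
bijection (injective because a stabiliser character kills the involution `x ∈ 𝒦(G, c)`, surjective by `extend_mem_charK`). [folklore] -/
theorem indexTwoRank_stabGen_spectator (hcH : c ∈ H) (hc2 : c * c = 1) (hc1 : c ≠ 1) (hcen : ∀ g : G, g * c = c * g)
    (hH : H.index = 2) {x : G} (hx : x ∉ H) (hxx : x * x = 1) (hxc : ∀ g : G, g * x = x * g) :
    indexTwoRank (stabGen c) = indexTwoRank (stabGen (⟨c, hcH⟩ : H)) := by
  have hc2' := csub_mul_csub hcH hc2
  have hcen' : ∀ k : H, k * ⟨c, hcH⟩ = ⟨c, hcH⟩ * k := fun k => csub_comm hcH hcen k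
  -- the restriction equivalence
  let e : ↥(charK c) ≃ₗ[ZMod 2] ↥(charK (⟨c, hcH⟩ : H)) :=
    { toFun := fun χ => ⟨fun h : H => (χ : G → ZMod 2) h, restrict_mem_charK hcH hc2 hcen χ.2⟩
      map_add' := fun _ _ => rfl
      map_smul' := fun _ _ => rfl
      invFun := fun ψ => ⟨fun g : G => if hg : g ∈ H then (ψ : H → ZMod 2) ⟨g, hg⟩
          else (ψ : H → ZMod 2) ⟨x * g, xmul_mem_of_not_mem hH hx hg⟩, extend_mem_charK hcH hc2 hcen hH hx hxx hxc ψ.2⟩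
      left_inv := fun χ => by
        apply Subtype.ext; funext g
        show (if hg : g ∈ H then (χ : G → ZMod 2) ((⟨g, hg⟩ : H) : G)
          else (χ : G → ZMod 2) ((⟨x * g, xmul_mem_of_not_mem hH hx hg⟩ : H) : G)) = (χ : G → ZMod 2) g
        by_cases hg : g ∈ H
        · rw [dif_pos hg]
        · rw [dif_neg hg]
          show (χ : G → ZMod 2) (x * g) = (χ : G → ZMod 2) g
          have hadd := ((mem_charK c (χ : G → ZMod 2)).mp χ.2).1
          have hx0 : (χ : G → ZMod 2) x = 0 :=
            apply_eq_zero_of_mem_charK c hc2 hcen χ.2 (mem_stabGen_of_mul_self_eq_one c hc1 hxx)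
          rw [hadd, hx0, zero_add]
      right_inv := fun ψ => by
        apply Subtype.ext; funext h
        show (if hg : (h : G) ∈ H then (ψ : H → ZMod 2) ⟨(h : G), hg⟩
          else (ψ : H → ZMod 2) ⟨x * (h : G), xmul_mem_of_not_mem hH hx hg⟩) = (ψ : H → ZMod 2) h
        rw [dif_pos h.2] }
  rw [← finrank_charK_eq_indexTwoRank c hc2 hcen, ← finrank_charK_eq_indexTwoRank _ hc2' hcen', e.finrank_eq]

/-! ## §3 The fibre: `φ₂(G, c) + 2 = β(G, c) + d₂(H/𝒦_H)` -/

/-- **`φ₂(G, c) + 2 = β(G, c) + d₂(H/𝒦(H, c))`** for the spectator doubling. [folklore] -/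
theorem fibreTwo_add_two_spectator (hcH : c ∈ H) (hc2 : c * c = 1) (hc1 : c ≠ 1) (hcen : ∀ g : G, g * c = c * g)
    (hH : H.index = 2) {x : G} (hx : x ∉ H) (hxx : x * x = 1) (hxc : ∀ g : G, g * x = x * g) :
    fibreTwo c hc2 + 2 = Fintype.card (Block c) + indexTwoRank (stabGen (⟨c, hcH⟩ : H)) := by
  rw [← indexTwoRank_stabGen_spectator hcH hc2 hc1 hcen hH hx hxx hxc]
  exact fibreTwo_add_two_eq_card_block_add_indexTwoRank c hc2 hc1 hcen (even_card_div_two hcH hc2 hc1 hH)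

/-- **The fibre against `(H, c)`**: `φ₂(G, c) + β(H, c) + [|H|/2 even] = φ₂(H, c) + β(G, c) + 1` — for `|H|/2` even the coinvariant fibre grows by
exactly the number of new blocks, for `|H|/2` odd by one less. [folklore] -/
theorem fibreTwo_spectator_eq (hcH : c ∈ H) (hc2 : c * c = 1) (hc1 : c ≠ 1) (hcen : ∀ g : G, g * c = c * g)
    (hH : H.index = 2) {x : G} (hx : x ∉ H) (hxx : x * x = 1) (hxc : ∀ g : G, g * x = x * g) :
    fibreTwo c hc2 + Fintype.card (Block (⟨c, hcH⟩ : H)) + 1 =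
      fibreTwo (⟨c, hcH⟩ : H) (csub_mul_csub hcH hc2) + (if Even (Fintype.card H / 2) then 1 else 0) + Fintype.card (Block c) := by
  have hc2' := csub_mul_csub hcH hc2
  have hcen' : ∀ k : H, k * ⟨c, hcH⟩ = ⟨c, hcH⟩ * k := fun k => csub_comm hcH hcen k
  have hG := fibreTwo_add_two_spectator hcH hc2 hc1 hcen hH hx hxx hxc
  have hHf := fibreTwo_add_eq_card_block_add_indexTwoRank (⟨c, hcH⟩ : H) hc2' (csub_ne_one hcH hc1) hcen'
  omega

/-! ## §4 The floor `μ(G, c) ≥ β(G, c) − 2 + d₂(H/𝒦_H)` -/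

/-- **THE SPECTATOR FLOOR**: every family `S` of faces whose base changes generate `hodgeSpan (G, c)` modulo pairs has
`β(G, c) + d₂(H/𝒦(H, c)) ≤ |S| + 2`. [folklore] -/
theorem card_block_add_le_spectator (hcH : c ∈ H) (hc2 : c * c = 1) (hc1 : c ≠ 1) (hcen : ∀ g : G, g * c = c * g)
    (hH : H.index = 2) {x : G} (hx : x ∉ H) (hxx : x * x = 1) (hxc : ∀ g : G, g * x = x * g)
    (S : Finset (CMF G c →₀ ℤ)) (hSF : (S : Set (CMF G c →₀ ℤ)) ⊆ gfaceSet G c hc2)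
    (hgen : hodgeSpan c hc2 ≤ Submodule.span ℤ (pairSet c) ⊔ Submodule.span ℤ (translates c S)) :
    Fintype.card (Block c) + indexTwoRank (stabGen (⟨c, hcH⟩ : H)) ≤ S.card + 2 := by
  have hfloor := OcticProduct.fibreTwo_mem_lowerBounds hc2 hcen ⟨S, hSF, rfl, hgen⟩
  have h := fibreTwo_add_two_spectator hcH hc2 hc1 hcen hH hx hxx hxc
  omega

/-- The floor in `lowerBounds` form. [folklore] -/
theorem mem_lowerBounds_spectator (hcH : c ∈ H) (hc2 : c * c = 1) (hc1 : c ≠ 1) (hcen : ∀ g : G, g * c = c * g)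
    (hH : H.index = 2) {x : G} (hx : x ∉ H) (hxx : x * x = 1) (hxc : ∀ g : G, g * x = x * g) :
    Fintype.card (Block c) + indexTwoRank (stabGen (⟨c, hcH⟩ : H)) - 2 ∈
      lowerBounds {m : ℕ | ∃ S : Finset (CMF G c →₀ ℤ), ↑S ⊆ gfaceSet G c hc2 ∧ S.card = m ∧
        hodgeSpan c hc2 ≤ Submodule.span ℤ (pairSet c) ⊔ Submodule.span ℤ (translates c S)} := by
  rintro m ⟨S, hSF, rfl, hgen⟩
  have h := card_block_add_le_spectator hcH hc2 hc1 hcen hH hx hxx hxc S hSF hgen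
  omega

end

end Summit.HodgeConjecture.CorCM.Census.Spectator
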